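import Mathlib
import HarnessLib
import Literature.MathematicalPhysics.QuantumLattice.GaugeGroups
import Literature.MathematicalPhysics.QuantumFieldTheory.ConstructiveQFTWave0
import Literature.MathematicalPhysics.QuantumFieldTheory.UnitaryCayleyChart
import Summits.Ventures.LatticeQCDFlow.Scaling.ExactTransportVolumeR
import Summits.Ventures.LatticeQCDFlow.Scaling.ExactTransportUN
import Summits.Ventures.LatticeQCDFlow.Scaling.ExactTransportSUN
import Summits.Ventures.LatticeQCDFlow.Scaling.CircleBallVolume
import Summits.Ventures.LatticeQCDFlow.Scaling.ExtensiveActionInstances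
import Summits.Ventures.LatticeQCDFlow.Scaling.LatticeLaplaceHalfMassInstances
import Summits.Ventures.LatticeQCDFlow.Scaling.ExactTransportOneSided

/-!
# LatticeQCDFlow / Scaling — the one-sided transport laws for `U(1)`, `U(N)`, `SU(N)` with NO hypothesis left

HONEST FRAMING: exact (Metropolis-corrected) sampling algorithms for lattice gauge theory; figures of merit are
autocorrelation/cost numbers at stated couplings and volumes; no continuum-physics claim.

Venture `LatticeQCDFlow` (cell pub-lqcd), topic `Scaling`, FANOUT row 29 (theory-2) — OUR WORK (THEORY-2.md §3.3
v2.6; file 3 of 3).  `exactTransportExpansion_of_ballVolumes` and `exactTransportContraction_of_laplaceHalfMass`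
(`Scaling/ExactTransportOneSided.lean`) fed with the tree's two-sided Haar ball volumes (`U1.haar_closedBall_ge'/le'`,
`UN.haar_closedBall_ge/le`, `SUN.haar_closedBall_ge/le` — Hilbert–Schmidt metric on `U(N)`, `SU(N) ⊆ M_N(ℂ)`,
chordal metric on `U(1) = Circle`), a non-constant character (`Re tr(-1) = -N`, `Re tr e^{iπ} = -1`, resp. the
positive-action configuration of `SUN.exists_action_ge`) and the PROVED Laplace half-mass laws
`U1/UN/SUN.laplaceHalfMass` (`nTr(L) = κ·((d-1)L^d(1-3/L) - 2) ≥ κ·L^d/8` for `L ≥ 4`, `d ≥ 2`: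
`pow_div_eight_le_nTr`):

* `U1.exactTransportExpansion d (2 ≤ d)`, `UN.exactTransportExpansion d N (2 ≤ d) (1 ≤ N)`,
  `SUN.exactTransportExpansion d N (2 ≤ d) (2 ≤ N)`: `Lip(T) ≥ e^{cβ}` for every exact Lipschitz transport of
  `Haar^{⊗E}` onto the Wilson law, every `L ≥ 2`, `β ≥ β₀`, uniformly in `L` (`c = s₀/(8κd)`);
* `U1.exactTransportContraction`, `UN.exactTransportContraction`, `SUN.exactTransportContraction` (same ranges):
  `log coLip(T) ≥ (1/(16d))·log β - C`, every `L ≥ 4`, `β ≥ β₀`.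

`SU(3)`, `d = 4` is included in both.  Elementary given the tree; nothing here is cited as a fact.
-/

noncomputable section

namespace Summit.Ventures.LatticeQCDFlow.Theory2.Lattice

open MeasureTheory Metric Set Literature.MathematicalPhysics.QuantumFieldTheory

/-- `(d-1)·L^d·(1 - 3/L) - 2 ≥ L^d/8` for `d ≥ 2`, `L ≥ 4`: the transverse count of the tree's Laplace half-mass
instances is `≥ κ·L^d/8` there. [folklore] -/
theorem pow_div_eight_le_nTr {d L : ℕ} (hd : 2 ≤ d) (hL : 4 ≤ L) :
    (L : ℝ) ^ d / 8 ≤ ((d : ℝ) - 1) * (L : ℝ) ^ d * (1 - 3 / L) - 2 := by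
  have hL4 : (4 : ℝ) ≤ L := by exact_mod_cast hL
  have hL0 : (0 : ℝ) < L := by linarith
  have hd1 : (1 : ℝ) ≤ (d : ℝ) - 1 := by
    have : (2 : ℝ) ≤ d := by exact_mod_cast hd
    linarith
  have hLd0 : (0 : ℝ) < (L : ℝ) ^ d := by positivity
  have h13 : (1 : ℝ) / 4 ≤ 1 - 3 / L := by
    rw [div_le_iff₀ (by norm_num : (0:ℝ) < 4)]
    have : 3 / (L : ℝ) ≤ 3 / 4 := div_le_div_of_nonneg_left (by norm_num) (by norm_num) hL4
    linarith
  have h16 : (16 : ℝ) ≤ (L : ℝ) ^ d := by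
    calc (16 : ℝ) = 4 ^ 2 := by norm_num
      _ ≤ (L : ℝ) ^ 2 := pow_le_pow_left₀ (by norm_num) hL4 2
      _ ≤ (L : ℝ) ^ d := pow_le_pow_right₀ (by linarith) hd
  have h1 : (L : ℝ) ^ d * (1 / 4) ≤ ((d : ℝ) - 1) * (L : ℝ) ^ d * (1 - 3 / L) := by
    calc (L : ℝ) ^ d * (1 / 4) = 1 * (L : ℝ) ^ d * (1 / 4) := by ring
      _ ≤ ((d : ℝ) - 1) * (L : ℝ) ^ d * (1 - 3 / L) :=
        mul_le_mul (mul_le_mul_of_nonneg_right hd1 hLd0.le) h13 (by norm_num)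
          (mul_nonneg (by linarith) hLd0.le)
  linarith


/-! ## §4. Instances with no hypothesis left: `U(1)`, `U(N)`, `SU(N)` -/

section Instances

open scoped Matrix.Norms.Frobenius
open Literature.MathematicalPhysics.QuantumFieldTheory.UnitaryCayley (𝔾)
open Literature.MathematicalPhysics.QuantumLattice (u1Rep continuous_u1Rep unitaryFundamentalRep
  continuous_unitaryFundamentalRep fundamentalRep continuous_fundamentalRep)

/-- **(C2a-E) for `U(1) = Circle`, `d ≥ 2`** (OURS): `Lip(T) ≥ e^{cβ}` for every exact Lipschitz transport of
`Haar^{⊗E}` onto the `U(1)` Wilson law, `L ≥ 2`, `β ≥ β₀`, uniformly in `L`. [folklore] -/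
theorem U1.exactTransportExpansion (d : ℕ) (hd : 2 ≤ d) : ExactTransportExpansion d 1 Circle u1Rep := by
  obtain ⟨a, ha, hlo⟩ := U1.haar_closedBall_ge'
  obtain ⟨A, _, hup⟩ := U1.haar_closedBall_le'
  exact exactTransportExpansion_of_ballVolumes u1Rep d hd continuous_u1Rep U1.re_trace_u1Rep_le
    U1.neg_one_le_re_trace ⟨Circle.exp Real.pi, by rw [U1.re_trace_exp_pi]; norm_num⟩ one_pos ha hlo hup

/-- **(C2a-C) for `U(1) = Circle`, `d ≥ 2`** (OURS): `log coLip(T) ≥ (1/(16d))·log β - C` for every exact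
co-Lipschitz transport of `Haar^{⊗E}` onto the `U(1)` Wilson law, `L ≥ 4`, `β ≥ β₀`. [folklore] -/
theorem U1.exactTransportContraction (d : ℕ) (hd : 2 ≤ d) : ExactTransportContraction d 1 Circle u1Rep := by
  obtain ⟨a, ha, hlo⟩ := U1.haar_closedBall_ge'
  obtain ⟨A, _, hup⟩ := U1.haar_closedBall_le'
  refine exactTransportContraction_of_laplaceHalfMass u1Rep d (by omega) continuous_u1Rep U1.re_trace_u1Rep_le
    U1.neg_one_le_re_trace one_pos ha hlo hup (U1.laplaceHalfMass d) (q := 1 / 8) (by norm_num) (L₀ := 4)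
    fun L hL => ?_
  have h := pow_div_eight_le_nTr hd hL
  linarith

/-- **(C2a-E) for `U(N)`, `N ≥ 1`, `d ≥ 2`, Hilbert–Schmidt metric** (OURS): `Lip(T) ≥ e^{cβ}` for every exact
Lipschitz transport of `Haar^{⊗E}` onto the `U(N)` Wilson law, `L ≥ 2`, `β ≥ β₀`, uniformly in `L`. [folklore] -/
theorem UN.exactTransportExpansion (d N : ℕ) (hd : 2 ≤ d) (hN : 1 ≤ N) :
    @ExactTransportExpansion d N (𝔾 N) _ Subtype.metricSpace UN.isTopologicalGroup_hs UN.compactSpace_hs _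
      UN.borelSpace_hs (unitaryFundamentalRep (Fin N) ℂ) := by
  obtain ⟨a, ha, hlo⟩ := UN.haar_closedBall_ge (N := N)
  obtain ⟨A, hA, hup⟩ := UN.haar_closedBall_le (N := N)
  have hκ : 0 < N * N := Nat.mul_pos (by omega) (by omega)
  have hnc : ∃ g : 𝔾 N, (unitaryFundamentalRep (Fin N) ℂ g).trace.re ≠ N := ⟨-1, by
    rw [UN.re_trace_neg_one]
    have : (1 : ℝ) ≤ N := by exact_mod_cast hN
    linarith⟩
  exact @exactTransportExpansion_of_ballVolumes N (𝔾 N) _ Subtype.metricSpace UN.isTopologicalGroup_hs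
    UN.compactSpace_hs UN.secondCountable_hs _ UN.borelSpace_hs (unitaryFundamentalRep (Fin N) ℂ) d hd
    (continuous_unitaryFundamentalRep (Fin N) ℂ) UN.re_trace_le UN.neg_le_re_trace hnc (N * N) hκ a A ha hlo
    (fun g r hr => hup g r hr)

/-- **(C2a-C) for `U(N)`, `N ≥ 1`, `d ≥ 2`, Hilbert–Schmidt metric** (OURS): `log coLip(T) ≥ (1/(16d))·log β - C`
for every exact co-Lipschitz transport of `Haar^{⊗E}` onto the `U(N)` Wilson law, `L ≥ 4`, `β ≥ β₀`. [folklore] -/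
theorem UN.exactTransportContraction (d N : ℕ) (hd : 2 ≤ d) (hN : 1 ≤ N) :
    @ExactTransportContraction d N (𝔾 N) _ Subtype.metricSpace UN.isTopologicalGroup_hs UN.compactSpace_hs _
      UN.borelSpace_hs (unitaryFundamentalRep (Fin N) ℂ) := by
  obtain ⟨a, ha, hlo⟩ := UN.haar_closedBall_ge (N := N)
  obtain ⟨A, hA, hup⟩ := UN.haar_closedBall_le (N := N)
  have hκ : 0 < N * N := Nat.mul_pos (by omega) (by omega)
  have hq : (0 : ℝ) < (N : ℝ) ^ 2 / 8 := by positivity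
  refine @exactTransportContraction_of_laplaceHalfMass N (𝔾 N) _ Subtype.metricSpace UN.isTopologicalGroup_hs
    UN.compactSpace_hs UN.secondCountable_hs _ UN.borelSpace_hs (unitaryFundamentalRep (Fin N) ℂ) d (by omega)
    (continuous_unitaryFundamentalRep (Fin N) ℂ) UN.re_trace_le UN.neg_le_re_trace (N * N) hκ a A ha hlo
    (fun g r hr => hup g r hr) _ (UN.laplaceHalfMass d N) ((N : ℝ) ^ 2 / 8) hq 4 fun L hL => ?_
  have h := pow_div_eight_le_nTr hd hL
  have hN2 : (0 : ℝ) ≤ (N : ℝ) ^ 2 := sq_nonneg _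
  calc (N : ℝ) ^ 2 / 8 * (L : ℝ) ^ d = (N : ℝ) ^ 2 * ((L : ℝ) ^ d / 8) := by ring
    _ ≤ (N : ℝ) ^ 2 * (((d : ℝ) - 1) * (L : ℝ) ^ d * (1 - 3 / L) - 2) := mul_le_mul_of_nonneg_left h hN2

/-- **(C2a-E) for `SU(N)`, `N ≥ 2`, `d ≥ 2`, Hilbert–Schmidt metric** (OURS; `SU(3)`, `d = 4` included):
`Lip(T) ≥ e^{cβ}` for every exact Lipschitz transport of `Haar^{⊗E}` onto the `SU(N)` Wilson law, `L ≥ 2`, `β ≥ β₀`,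
uniformly in `L`. [folklore] -/
theorem SUN.exactTransportExpansion (d N : ℕ) (hd : 2 ≤ d) (hN : 2 ≤ N) :
    @ExactTransportExpansion d N (Matrix.specialUnitaryGroup (Fin N) ℂ) _ Subtype.metricSpace
      SUN.isTopologicalGroup_hs SUN.compactSpace_hs _ SUN.borelSpace_hs (fundamentalRep (Fin N)) := by
  haveI : NeZero N := ⟨by omega⟩
  obtain ⟨a, ha, hlo⟩ := SUN.haar_closedBall_ge (N := N)
  obtain ⟨A, hA, hup⟩ := SUN.haar_closedBall_le (N := N)
  have hκ : 0 < N * N - 1 := by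
    have : 2 * 2 ≤ N * N := Nat.mul_le_mul hN hN
    omega
  have hnc : ∃ g : Matrix.specialUnitaryGroup (Fin N) ℂ, (fundamentalRep (Fin N) g).trace.re ≠ N := by
    by_contra h
    simp only [not_exists, ne_eq, not_not] at h
    obtain ⟨V, hV⟩ := SUN.exists_action_ge hN hd 1
    have hS : wilsonAction (fundamentalRep (Fin N)) V = 0 := by
      unfold wilsonAction
      exact Finset.sum_eq_zero fun p _ => by rw [h, sub_self]
    rw [hS] at hV
    norm_num at hV
  exact @exactTransportExpansion_of_ballVolumes N (Matrix.specialUnitaryGroup (Fin N) ℂ) _ Subtype.metricSpace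
    SUN.isTopologicalGroup_hs SUN.compactSpace_hs SUN.secondCountable_hs _ SUN.borelSpace_hs (fundamentalRep (Fin N))
    d hd (continuous_fundamentalRep (Fin N)) (SUN.re_trace_le N) SUN.neg_le_re_trace hnc (N * N - 1) hκ a A ha
    hlo (fun g r hr => hup g r hr)

/-- **(C2a-C) for `SU(N)`, `N ≥ 2`, `d ≥ 2`, Hilbert–Schmidt metric** (OURS; `SU(3)`, `d = 4` included):
`log coLip(T) ≥ (1/(16d))·log β - C` for every exact co-Lipschitz transport of `Haar^{⊗E}` onto the `SU(N)` Wilson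
law, `L ≥ 4`, `β ≥ β₀`. [folklore] -/
theorem SUN.exactTransportContraction (d N : ℕ) (hd : 2 ≤ d) (hN : 2 ≤ N) :
    @ExactTransportContraction d N (Matrix.specialUnitaryGroup (Fin N) ℂ) _ Subtype.metricSpace
      SUN.isTopologicalGroup_hs SUN.compactSpace_hs _ SUN.borelSpace_hs (fundamentalRep (Fin N)) := by
  haveI : NeZero N := ⟨by omega⟩
  obtain ⟨a, ha, hlo⟩ := SUN.haar_closedBall_ge (N := N)
  obtain ⟨A, hA, hup⟩ := SUN.haar_closedBall_le (N := N)
  have hκ : 0 < N * N - 1 := by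
    have : 2 * 2 ≤ N * N := Nat.mul_le_mul hN hN
    omega
  have hq : (0 : ℝ) < ((N : ℝ) ^ 2 - 1) / 8 := by
    have : (2 : ℝ) ≤ N := by exact_mod_cast hN
    have : (4 : ℝ) ≤ (N : ℝ) ^ 2 := by nlinarith
    linarith
  refine @exactTransportContraction_of_laplaceHalfMass N (Matrix.specialUnitaryGroup (Fin N) ℂ) _
    Subtype.metricSpace SUN.isTopologicalGroup_hs SUN.compactSpace_hs SUN.secondCountable_hs _ SUN.borelSpace_hs
    (fundamentalRep (Fin N)) d (by omega) (continuous_fundamentalRep (Fin N)) (SUN.re_trace_le N)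
    SUN.neg_le_re_trace (N * N - 1) hκ a A ha hlo (fun g r hr => hup g r hr) _ (SUN.laplaceHalfMass d N (by omega))
    (((N : ℝ) ^ 2 - 1) / 8) hq 4 fun L hL => ?_
  have h := pow_div_eight_le_nTr hd hL
  calc ((N : ℝ) ^ 2 - 1) / 8 * (L : ℝ) ^ d = ((N : ℝ) ^ 2 - 1) * ((L : ℝ) ^ d / 8) := by ring
    _ ≤ ((N : ℝ) ^ 2 - 1) * (((d : ℝ) - 1) * (L : ℝ) ^ d * (1 - 3 / L) - 2) :=
      mul_le_mul_of_nonneg_left h (by linarith)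

end Instances

end Summit.Ventures.LatticeQCDFlow.Theory2.Lattice

end
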